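import Mathlib.Analysis.SpecialFunctions.Complex.Log
import Mathlib.Algebra.Field.GeomSum
import Mathlib.Data.Complex.BigOperators

/-!
# Ring saturation one site early (T-M1D.26), part 1/3: the root-of-unity sums of the certificate

HONEST FRAMING: first certified bounds; not a superconductivity verdict; every number certified
or labelled float.  (Venture `CertifiedManyBodySolver`, programme `hubbard-alg`, team M1 seat 4,
structure notes `STRUCTURE-TM1-doped.md` entry T-M1D.26; proof of record with the discovery path
`structure/ringsat/RING-SAT-THEOREM.md`; setting and notation of `OneBodySection.lean`.)

The general theorem (`RingSaturationGeneral.lean`: for every `L ≥ 3`, `1 ≤ N ≤ L − 1`, a one-body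
sequence with `g 0 = N/L` and `0 ⪯ T_{L−1}(g) ⪯ 1` has `g 1 ≤ sin(πN/L)/(L sin(π/L))`, attained by
the twisted free `L`-ring) rests on a closed-form dual certificate built from the `L` momentum
BONDS `n = 0,…,L−1` joining the twisted ring momenta `θ_n = (1 − N + 2n)π/L` and
`θ_{n+1} = θ_n + 2π/L`: bond midpoint `φ_n = θ_n + π/L`, bond function
`G_n = cos(πN/L) − cos φ_n`.  Everything analytic in its verification is a ROOT-OF-UNITY SUM;
this file proves them for symbolic `L, N`:

* `sum_exp_arith_eq_zero` — `Σ_{n<L} exp(i(a + 2πkn/L)) = 0` for `k ∈ ℤ`, `L ∤ k` (geometric sum);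
* the bond symbol `c(m) = Σ_n G_n e^{imθ_n}` (`bondSum`): `bondSum_expand` and its values
  `c(0) = L·cos(πN/L)`, `c(±1) = −(L/2)e^{∓iπ/L}`, `c(m) = 0` for `2 ≤ |m| ≤ L − 2`;
* the window sums over the `L − 1` sites `s = 1,…,L−1` of the site factor `a_s = 1 − ω^s`,
  `ω = e^{2πi/L}`: `Σ|a_s|² = 2L` (`windowSum_zero`) and `Σ a_{s+1}ā_s = L(1 + ω)` (`windowSum_one`);
* the signs of the bond function: `G_n ≤ 0` on the occupied bonds `n + 2 ≤ N`, `G_n ≥ 0` on the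
  unoccupied ones `N ≤ n + 1 ≤ L` (`G_nonpos`, `G_nonneg`), and `cos(π/L) > 0`.
-/

namespace Summit.Ventures.CertifiedManyBodySolver.Conjectures.RingSaturation

open Complex Finset
open scoped Real

/-- `((cos x : ℝ) : ℂ) = (e^{ix} + e^{-ix})/2`. -/
theorem ofReal_cos_eq (x : ℝ) :
    ((Real.cos x : ℝ) : ℂ) = (cexp (x * I) + cexp (-(x * I))) / 2 := by
  rw [Complex.ofReal_cos]
  have h := Complex.two_cos (x : ℂ)
  rw [neg_mul] at h
  rw [← h]; ring

/-- Root-of-unity sums along an arithmetic progression vanish: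
`Σ_{n<L} exp(a·i + n·(2πik/L)) = 0` whenever `L ∤ k`. -/
theorem sum_exp_arith_eq_zero (L : ℕ) (hL : 1 ≤ L) (k : ℤ) (hk : ¬ (L : ℤ) ∣ k) (a : ℝ) :
    ∑ n ∈ range L, cexp (a * I + n * (2 * π * I * k / L)) = 0 := by
  have hL' : (L : ℂ) ≠ 0 := by exact_mod_cast (by omega : L ≠ 0)
  have h2 : (2 * π * I : ℂ) ≠ 0 := by simp [Real.pi_ne_zero, I_ne_zero]
  have hz : cexp (2 * π * I * k / L) ≠ 1 := by
    intro h
    obtain ⟨m, hm⟩ := Complex.exp_eq_one_iff.mp h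
    rw [div_eq_iff hL'] at hm
    have h3 : (2 * π * I : ℂ) * ((k : ℂ) - L * m) = 0 := by linear_combination hm
    have h4 : (k : ℂ) = L * m := by
      have := (mul_eq_zero.mp h3).resolve_left h2
      exact sub_eq_zero.mp this
    apply hk
    refine ⟨m, ?_⟩
    have h5 : ((k : ℤ) : ℂ) = (((L : ℤ) * m : ℤ) : ℂ) := by push_cast; exact h4
    exact_mod_cast h5
  have hzL : cexp (2 * π * I * k / L) ^ L = 1 := by
    rw [← Complex.exp_nat_mul]
    have : (L : ℂ) * (2 * π * I * k / L) = k * (2 * π * I) := by field_simp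
    rw [this]; exact Complex.exp_int_mul_two_pi_mul_I k
  calc ∑ n ∈ range L, cexp (a * I + n * (2 * π * I * k / L))
      = ∑ n ∈ range L, cexp (a * I) * cexp (2 * π * I * k / L) ^ n := by
          refine sum_congr rfl fun n _ => ?_
          rw [Complex.exp_add, Complex.exp_nat_mul]
    _ = cexp (a * I) * ∑ n ∈ range L, cexp (2 * π * I * k / L) ^ n := by rw [mul_sum]
    _ = 0 := by rw [geom_sum_eq hz, hzL]; simp

variable (L N : ℕ)

/-- Momentum-bond angle `θ_n = (1 − N + 2n)π/L` (the ring momenta with the optimal twist are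
`θ_0, …, θ_{N−1}`). -/
noncomputable def θ (n : ℕ) : ℝ := (1 - N + 2 * n) * π / L

/-- Bond function `G_n = cos(πN/L) − cos(θ_n + π/L)`: zero on the two Fermi bonds, negative on the
occupied bonds `n ≤ N − 2`, positive on the unoccupied ones `N ≤ n ≤ L − 2`. -/
noncomputable def G (n : ℕ) : ℝ := Real.cos (π * N / L) - Real.cos (θ L N n + π / L)

/-- `A(k) = Σ_{n<L} e^{ikθ_n}`. -/
noncomputable def A (k : ℤ) : ℂ := ∑ n ∈ range L, cexp (k * θ L N n * I)

/-- The bond sum `c(m) = Σ_{n<L} G_n e^{imθ_n}` (the symbol of the bond-Laplacian certificate). -/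
noncomputable def bondSum (m : ℤ) : ℂ := ∑ n ∈ range L, (G L N n : ℂ) * cexp (m * θ L N n * I)

/-- The progression sum `A(k)` vanishes unless `L ∣ k`. -/
theorem A_eq_zero (hL : 1 ≤ L) {k : ℤ} (hk : ¬ (L : ℤ) ∣ k) : A L N k = 0 := by
  unfold A
  have h := sum_exp_arith_eq_zero L hL k hk (k * θ L N 0)
  rw [← h]
  refine sum_congr rfl fun n _ => ?_
  congr 1
  simp only [θ]
  push_cast
  field_simp
  ring

/-- `A(0) = L`. -/
theorem A_zero : A L N 0 = L := by
  simp [A]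

/-- Master expansion of the bond sum into three arithmetic-progression sums. -/
theorem bondSum_expand (m : ℤ) :
    bondSum L N m = Real.cos (π * N / L) * A L N m
      - 1 / 2 * (cexp (π / L * I) * A L N (m + 1) + cexp (-(π / L * I)) * A L N (m - 1)) := by
  unfold bondSum A
  rw [mul_sum, mul_sum, mul_sum, ← sum_add_distrib, mul_sum, ← sum_sub_distrib]
  refine sum_congr rfl fun n _ => ?_
  have h1 : cexp ((θ L N n + π / L : ℝ) * I) * cexp (m * θ L N n * I)
      = cexp (π / L * I) * cexp (((m + 1 : ℤ) : ℂ) * θ L N n * I) := by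
    rw [← Complex.exp_add, ← Complex.exp_add]; congr 1; push_cast; ring
  have h2 : cexp (-((θ L N n + π / L : ℝ) * I)) * cexp (m * θ L N n * I)
      = cexp (-(π / L * I)) * cexp (((m - 1 : ℤ) : ℂ) * θ L N n * I) := by
    rw [← Complex.exp_add, ← Complex.exp_add]; congr 1; push_cast; ring
  simp only [G]
  rw [Complex.ofReal_sub, ofReal_cos_eq (θ L N n + π / L), sub_mul, div_mul_eq_mul_div, add_mul,
    h1, h2]
  ring

/-- `c(0) = L·cos(πN/L)` (for `L ≥ 2`). -/
theorem bondSum_zero (hL : 2 ≤ L) : bondSum L N 0 = L * Real.cos (π * N / L) := by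
  rw [bondSum_expand, A_zero]
  have h1 : A L N (0 + 1) = 0 := A_eq_zero L N (by omega) (by
    intro ⟨c, hc⟩; have : (L : ℤ) ∣ 1 := ⟨c, by simpa using hc⟩
    have := Int.le_of_dvd one_pos this; omega)
  have h2 : A L N (0 - 1) = 0 := A_eq_zero L N (by omega) (by
    intro h; have : (L : ℤ) ∣ 1 := by simpa using h
    have := Int.le_of_dvd one_pos this; omega)
  rw [h1, h2]; ring

/-- `c(1) = −(L/2)·e^{−iπ/L}` (for `L ≥ 3`). -/
theorem bondSum_one (hL : 3 ≤ L) : bondSum L N 1 = -(L / 2) * cexp (-(π / L * I)) := by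
  rw [bondSum_expand]
  have h0 : A L N 1 = 0 := A_eq_zero L N (by omega) (by
    intro h; have := Int.le_of_dvd one_pos h; omega)
  have h1 : A L N (1 + 1) = 0 := A_eq_zero L N (by omega) (by
    intro h; have := Int.le_of_dvd (by norm_num) h; omega)
  have h2 : A L N (1 - 1) = L := by simpa using A_zero L N
  rw [h0, h1, h2]; ring

/-- `c(m) = 0` for `2 ≤ m ≤ L − 2`. -/
theorem bondSum_eq_zero {m : ℤ} (hm : 2 ≤ m) (hmL : m + 2 ≤ L) : bondSum L N m = 0 := by
  rw [bondSum_expand]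
  have hL : 1 ≤ L := by omega
  have key : ∀ k : ℤ, 1 ≤ k → k + 1 ≤ L → A L N k = 0 := fun k hk hkL =>
    A_eq_zero L N hL (by intro h; have := Int.le_of_dvd (by omega) h; omega)
  rw [key m (by omega) (by omega), key (m + 1) (by omega) (by omega),
    key (m - 1) (by omega) (by omega)]
  ring

/-- Negative offsets by symmetry: `c(−m) = conj c(m)`-free statement `c(−m) = 0` for
`2 ≤ m ≤ L − 2`. -/
theorem bondSum_neg_eq_zero {m : ℤ} (hm : 2 ≤ m) (hmL : m + 2 ≤ L) : bondSum L N (-m) = 0 := by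
  rw [bondSum_expand]
  have hL : 1 ≤ L := by omega
  have key : ∀ k : ℤ, 1 ≤ -k → -k + 1 ≤ L → A L N k = 0 := fun k hk hkL =>
    A_eq_zero L N hL (by
      intro h; have h' : (L : ℤ) ∣ -k := (dvd_neg).mpr h
      have := Int.le_of_dvd (by omega) h'; omega)
  rw [key (-m) (by omega) (by omega), key (-m + 1) (by omega) (by omega),
    key (-m - 1) (by omega) (by omega)]
  ring

/-- `c(−1) = −(L/2)·e^{+iπ/L}` (for `L ≥ 3`). -/
theorem bondSum_neg_one (hL : 3 ≤ L) : bondSum L N (-1) = -(L / 2) * cexp (π / L * I) := by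
  rw [bondSum_expand]
  have h0 : A L N (-1) = 0 := A_eq_zero L N (by omega) (by
    intro h; have h' : (L:ℤ) ∣ 1 := by simpa using h
    have := Int.le_of_dvd one_pos h'; omega)
  have h1 : A L N (-1 + 1) = L := by simpa using A_zero L N
  have h2 : A L N (-1 - 1) = 0 := A_eq_zero L N (by omega) (by
    intro h; have h' : (L:ℤ) ∣ 2 := by
      have : (-1 - 1 : ℤ) = -2 := by norm_num
      rw [this, dvd_neg] at h; exact h
    have := Int.le_of_dvd (by norm_num) h'; omega)
  rw [h0, h1, h2]; ring


/-! ## Window sums over the `L − 1` sites -/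

/-- The site factor `a_s = 1 − ω^s`, `ω = e^{2πi/L}` (site `s = x + 1` for window index `x`). -/
noncomputable def siteFac (s : ℕ) : ℂ := 1 - cexp (s * (2 * π / L) * I)

/-- `Σ_{s<L} ω^s = 0` and `Σ_{s<L} ω^{-s} = 0` for `L ≥ 2`. -/
theorem sum_omega_pow (hL : 2 ≤ L) : ∑ s ∈ range L, cexp (s * (2 * π / L) * I) = 0 := by
  have h := sum_exp_arith_eq_zero L (by omega) 1 (by
    intro h; have := Int.le_of_dvd one_pos h; omega) 0
  rw [← h]; refine sum_congr rfl fun s _ => ?_; congr 1; push_cast; ring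

/-- `Σ_{s<L} ω^{-s} = 0` for `L ≥ 2`. -/
theorem sum_omega_pow_neg (hL : 2 ≤ L) : ∑ s ∈ range L, cexp (-(s * (2 * π / L) * I)) = 0 := by
  have h := sum_exp_arith_eq_zero L (by omega) (-1) (by
    intro h; have h' : (L:ℤ) ∣ 1 := by simpa using h
    have := Int.le_of_dvd one_pos h'; omega) 0
  rw [← h]; refine sum_congr rfl fun s _ => ?_; congr 1; push_cast; ring

/-- conj of `e^{it}` for real `t`. -/
theorem conj_cexp_mul_I (t : ℝ) : (starRingEnd ℂ) (cexp (t * I)) = cexp (-(t * I)) := by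
  rw [← Complex.exp_conj]; congr 1
  simp [Complex.conj_ofReal]

/-- Complex conjugate of the site factor. -/
theorem conj_siteFac (s : ℕ) :
    (starRingEnd ℂ) (siteFac L s) = 1 - cexp (-(s * (2 * π / L) * I)) := by
  unfold siteFac
  rw [map_sub, map_one]
  have : ((s : ℝ) * (2 * π / L) : ℝ) = ((s : ℂ) * (2 * π / L) : ℂ) := by push_cast; ring
  have h := conj_cexp_mul_I ((s : ℝ) * (2 * π / L))
  rw [this] at h
  rw [h]

/-- `W₀ = Σ_{x<L−1} |a_{x+1}|² = 2L`. -/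
theorem windowSum_zero (hL : 2 ≤ L) :
    ∑ x ∈ range (L - 1), siteFac L (x + 1) * (starRingEnd ℂ) (siteFac L (x + 1)) = 2 * L := by
  have key : ∀ s : ℕ, siteFac L s * (starRingEnd ℂ) (siteFac L s)
      = 2 - cexp (s * (2 * π / L) * I) - cexp (-(s * (2 * π / L) * I)) := by
    intro s
    rw [conj_siteFac, siteFac]
    have : cexp (s * (2 * π / L) * I) * cexp (-(s * (2 * π / L) * I)) = 1 := by
      rw [← Complex.exp_add]; simp
    linear_combination this
  simp_rw [key]
  -- extend the sum to `s < L`: the `s = 0` term is `2 - 1 - 1 = 0`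
  have hsplit : ∑ x ∈ range (L - 1), (2 - cexp (((x + 1 : ℕ) : ℂ) * (2 * π / L) * I)
      - cexp (-(((x + 1 : ℕ) : ℂ) * (2 * π / L) * I)))
      = ∑ s ∈ range L, (2 - cexp ((s : ℂ) * (2 * π / L) * I) - cexp (-((s : ℂ) * (2 * π / L) * I))) := by
    obtain ⟨L', rfl⟩ : ∃ L', L = L' + 1 := ⟨L - 1, by omega⟩
    rw [Finset.sum_range_succ' (fun s => (2 - cexp ((s : ℂ) * (2 * π / (L' + 1 : ℕ)) * I)
      - cexp (-((s : ℂ) * (2 * π / (L' + 1 : ℕ)) * I))))]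
    norm_num
  rw [hsplit, sum_sub_distrib, sum_sub_distrib, sum_omega_pow L hL, sum_omega_pow_neg L hL]
  simp only [sum_const, card_range, sub_zero]
  ring

/-- `W₁ = Σ_{x<L−2} a_{x+2} conj(a_{x+1}) = L(1 + ω)`. -/
theorem windowSum_one (hL : 3 ≤ L) :
    ∑ x ∈ range (L - 2), siteFac L (x + 2) * (starRingEnd ℂ) (siteFac L (x + 1))
      = L * (1 + cexp ((2 * π / L) * I)) := by
  have key : ∀ s : ℕ, siteFac L (s + 1) * (starRingEnd ℂ) (siteFac L s)
      = (1 + cexp ((2 * π / L) * I)) - cexp ((s + 1 : ℕ) * (2 * π / L) * I)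
        - cexp (-(s * (2 * π / L) * I)) := by
    intro s
    rw [conj_siteFac, siteFac]
    have : cexp ((s + 1 : ℕ) * (2 * π / L) * I) * cexp (-(s * (2 * π / L) * I))
        = cexp ((2 * π / L) * I) := by
      rw [← Complex.exp_add]; congr 1; push_cast; ring
    linear_combination this
  have hre : ∀ x : ℕ, siteFac L (x + 2) * (starRingEnd ℂ) (siteFac L (x + 1))
      = siteFac L ((x + 1) + 1) * (starRingEnd ℂ) (siteFac L (x + 1)) := fun x => rfl
  simp_rw [hre, key]
  rw [sum_sub_distrib, sum_sub_distrib, sum_const, card_range]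
  -- the two geometric pieces: Σ_{x<L-2} ω^{x+2} = -1 - ω and Σ_{x<L-2} ω^{-(x+1)} = -1 - ω
  obtain ⟨L', hL'⟩ : ∃ L', L = L' + 2 := ⟨L - 2, by omega⟩
  have hω : cexp ((L : ℂ) * (2 * π / L) * I) = 1 := by
    have hL0 : (L : ℂ) ≠ 0 := by exact_mod_cast (by omega : L ≠ 0)
    have : (L : ℂ) * (2 * π / L) * I = (1 : ℕ) * (2 * π * I) := by field_simp; push_cast; ring
    rw [this]; exact Complex.exp_nat_mul_two_pi_mul_I 1
  have h1 : ∑ x ∈ range (L - 2), cexp (((x + 1 + 1 : ℕ) : ℂ) * (2 * π / L) * I)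
      = -1 - cexp ((2 * π / L) * I) := by
    have h := sum_omega_pow L (by omega)
    rw [hL', Finset.sum_range_succ', Finset.sum_range_succ'] at h
    rw [show L - 2 = L' by omega]
    have e0 : cexp (((0 : ℕ) : ℂ) * (2 * π / L) * I) = 1 := by simp
    have e1 : cexp (((0 + 1 : ℕ) : ℂ) * (2 * π / L) * I) = cexp ((2 * π / L) * I) := by
      congr 1; push_cast; ring
    rw [hL'] at e0 e1
    rw [e0, e1] at h
    rw [hL']
    linear_combination h
  have h2 : ∑ x ∈ range (L - 2), cexp (-(((x + 1 : ℕ) : ℂ) * (2 * π / L) * I))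
      = -1 - cexp ((2 * π / L) * I) := by
    have h := sum_omega_pow_neg L (by omega)
    rw [hL', Finset.sum_range_succ', Finset.sum_range_succ] at h
    rw [show L - 2 = L' by omega]
    have e0 : cexp (-(((0 : ℕ) : ℂ) * (2 * π / L) * I)) = 1 := by simp
    -- the top term `s = L' + 1 = L - 1`: ω^{-(L-1)} = ω
    have e1 : cexp (-(((L' + 1 : ℕ) : ℂ) * (2 * π / L) * I)) = cexp ((2 * π / L) * I) := by
      have : cexp (-(((L' + 1 : ℕ) : ℂ) * (2 * π / L) * I))
          = cexp ((2 * π / L) * I) * cexp (-((L : ℂ) * (2 * π / L) * I)) := by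
        rw [← Complex.exp_add]; congr 1; rw [hL']; push_cast; ring
      rw [this, Complex.exp_neg, hω]; simp
    rw [hL'] at e0 e1
    rw [e0, e1] at h
    rw [hL']
    push_cast at h ⊢
    linear_combination h
  have hc : ((L - 2 : ℕ) : ℂ) = (L : ℂ) - 2 := by
    rw [Nat.cast_sub (by omega : 2 ≤ L)]; norm_num
  rw [h1, h2, nsmul_eq_mul, hc]
  ring

/-! ## The weight `λ = 2/(L² cos(π/L))` and the signs of the bond function -/

/-- `cos(π/L) > 0` for `L ≥ 3` (so the weight `λ` is positive). -/
theorem cos_pi_div_pos (hL : 3 ≤ L) : 0 < Real.cos (π / L) := by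
  apply Real.cos_pos_of_mem_Ioo
  have hL' : (3 : ℝ) ≤ L := by exact_mod_cast hL
  constructor
  · have : 0 < π / L := by positivity
    have := Real.pi_pos
    linarith
  · rw [div_lt_div_iff_of_pos_left Real.pi_pos (by linarith) (by norm_num)]
    linarith

/-- Occupied bonds: `cos φ_n ≥ cos(πN/L)` for `n + 2 ≤ N ≤ L`. -/
theorem G_nonpos (hNL : N ≤ L) {n : ℕ} (hn : n + 2 ≤ N) : G L N n ≤ 0 := by
  unfold G θ
  have hL : (0 : ℝ) < L := by exact_mod_cast (show 0 < L by omega)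
  have hφ : (1 - (N : ℝ) + 2 * n) * π / L + π / L = (2 - (N : ℝ) + 2 * n) * π / L := by ring
  rw [hφ, sub_nonpos]
  rw [← Real.cos_abs ((2 - (N : ℝ) + 2 * n) * π / L)]
  apply Real.cos_le_cos_of_nonneg_of_le_pi (abs_nonneg _)
  · -- πN/L ≤ π
    have : (N : ℝ) ≤ L := by exact_mod_cast hNL
    rw [div_le_iff₀ hL]; nlinarith [Real.pi_pos]
  · rw [abs_le]
    have hn' : (n : ℝ) + 2 ≤ N := by exact_mod_cast hn
    have hn0 : (0 : ℝ) ≤ n := by exact_mod_cast Nat.zero_le n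
    constructor
    · rw [show -(π * N / L) = (-(N : ℝ)) * π / L by ring]
      apply div_le_div_of_nonneg_right _ hL.le
      apply mul_le_mul_of_nonneg_right _ Real.pi_pos.le
      linarith
    · rw [show π * N / L = (N : ℝ) * π / L by ring]
      apply div_le_div_of_nonneg_right _ hL.le
      apply mul_le_mul_of_nonneg_right _ Real.pi_pos.le
      linarith

/-- Unoccupied bonds: `cos φ_n ≤ cos(πN/L)` for `N ≤ n + 1`, `n + 1 ≤ L`. -/
theorem G_nonneg {n : ℕ} (hn : N ≤ n + 1) (hnL : n + 1 ≤ L) : 0 ≤ G L N n := by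
  unfold G θ
  have hL : (0 : ℝ) < L := by exact_mod_cast (show 0 < L by omega)
  have hφ : (1 - (N : ℝ) + 2 * n) * π / L + π / L = (2 - (N : ℝ) + 2 * n) * π / L := by ring
  rw [hφ, sub_nonneg]
  set φ := (2 - (N : ℝ) + 2 * n) * π / L with hφdef
  have hN0 : (0 : ℝ) ≤ π * N / L := by positivity
  have hn' : (N : ℝ) ≤ n + 1 := by exact_mod_cast hn
  have hnL' : (n : ℝ) + 1 ≤ L := by exact_mod_cast hnL
  have hlow : π * N / L ≤ φ := by
    rw [hφdef, show π * N / L = (N : ℝ) * π / L by ring]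
    apply div_le_div_of_nonneg_right _ hL.le
    apply mul_le_mul_of_nonneg_right _ Real.pi_pos.le
    linarith
  have hup : φ ≤ 2 * π - π * N / L := by
    rw [hφdef, show 2 * π - π * N / L = (2 * (L : ℝ) - N) * π / L by field_simp]
    apply div_le_div_of_nonneg_right _ hL.le
    apply mul_le_mul_of_nonneg_right _ Real.pi_pos.le
    linarith
  rcases le_or_gt φ π with h | h
  · exact Real.cos_le_cos_of_nonneg_of_le_pi hN0 h hlow
  · rw [← Real.cos_two_pi_sub φ]
    apply Real.cos_le_cos_of_nonneg_of_le_pi hN0 (by linarith) (by linarith)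


end Summit.Ventures.CertifiedManyBodySolver.Conjectures.RingSaturation
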